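import Summits.CriticalPhenomena.Ising3DConformalLimit.Theorems.FKParityRobustnessStrandShadowTwoReplica
import HarnessLib

/-!
# The two-replica (agreement-sponge) identities: stub `stub_replicaIdentities` of line `Sketch`
# for the crux `StrandShadow` (stmt-CriticalPhenomena-14626)

Route `FKParityRobustness`, sub-problem `Ising3DConformalLimit`.  On a finite simple graph `G`, free
boundary condition, zero field, inverse temperature `β` (any real), and four distinct sites
`a₀, a₁, a₂, a₃`, let `𝒜` be the sponge ensemble on `Finset V` with weights
`Zs(A) = Z^free_{A;2β} · Z^free_{Aᶜ;2β}`, blue functional `X(A) = 1[a₀,a₁ ∈ A] ⟨σ_{a₀}σ_{a₁}⟩^free_{A;2β}`,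
red functional `Y(A) = 1[a₂,a₃ ∉ A] ⟨σ_{a₂}σ_{a₃}⟩^free_{Aᶜ;2β}` and `E[f] = ∑_A Zs(A) f(A) / ∑_A Zs(A)`.
Then (`stub_replicaIdentities`, verbatim the registered stub of the lead's skeleton)

* `U₄(a) := ⟨σ_{a₀}σ_{a₁}σ_{a₂}σ_{a₃}⟩ − (G₀₁G₂₃ + G₀₂G₁₃ + G₀₃G₁₂) = 8 (E[XY] − E[X] E[Y])`,
* `G₀₁ = 2 E[X]`, `G₂₃ = 2 E[Y]`,

where `G_{ij} = ⟨σ_{a_i}σ_{a_j}⟩^free_{G;β}`.  Proof: by the duplicated-variables change of variables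
of `FKParityRobustnessStrandShadowTwoReplica` (`sponge_sum_eq`) each sponge sum is a two-replica
Boltzmann sum of `∏ (σ_x ± σ'_x)/2`; the latter are evaluated by the spin-flip symmetry of the
second replica (`dsum_eq_of_symm`: only the part even in `σ'` survives, and it is a sum of
products of one-replica moments): `∑_A Zs = Z²`, `∑_A Zs·X = Z·M₀₁/2`, `∑_A Zs·Y = Z·M₂₃/2`,
`8 ∑_A Zs·X·Y = Z·M₀₁₂₃ + M₀₁M₂₃ − M₀₂M₁₃ − M₀₃M₁₂` with `M_B = ∑_σ w_β(σ) σ_B`, `Z = M_∅`.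

References: J. L. Lebowitz, Comm. Math. Phys. 35 (1974) 87–92 (duplicated variables);
M. Aizenman, Comm. Math. Phys. 86 (1982) 1–48, Prop. 5.3 / §5 [AizenmanCMP1982].
Theorem-only file; exact finite identities.
-/

noncomputable section

open Finset SimpleGraph
open Literature.Probability.LatticeModels

namespace Summit.CriticalPhenomena.Ising3DConformalLimit.Theorems.StrandShadowSketch

open scoped Classical

variable {V : Type} [Fintype V] [DecidableEq V]

/-! ## Double replica sums with an even weight -/

section Algebra

variable (w : (V → ℤˣ) → ℝ)

/-- A double replica sum of a product observable factorises. -/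
theorem dsum_factor (f g : (V → ℤˣ) → ℝ) :
    ∑ σ : V → ℤˣ, ∑ σ' : V → ℤˣ, w σ * w σ' * (f σ * g σ') =
      (∑ σ : V → ℤˣ, w σ * f σ) * ∑ σ : V → ℤˣ, w σ * g σ := by
  rw [Finset.sum_mul_sum]
  exact Finset.sum_congr rfl fun σ _ => Finset.sum_congr rfl fun σ' _ => by ring

/-- Linearity and factorisation of a double replica sum, four-term shape. -/
theorem dsum_combo (f₁ g₁ f₂ g₂ f₃ g₃ f₄ g₄ : (V → ℤˣ) → ℝ) :
    ∑ σ : V → ℤˣ, ∑ σ' : V → ℤˣ, w σ * w σ' *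
        (f₁ σ * g₁ σ' + f₂ σ * g₂ σ' - f₃ σ * g₃ σ' - f₄ σ * g₄ σ') =
      (∑ σ : V → ℤˣ, w σ * f₁ σ) * (∑ σ : V → ℤˣ, w σ * g₁ σ) +
        (∑ σ : V → ℤˣ, w σ * f₂ σ) * (∑ σ : V → ℤˣ, w σ * g₂ σ) -
        (∑ σ : V → ℤˣ, w σ * f₃ σ) * (∑ σ : V → ℤˣ, w σ * g₃ σ) -
        (∑ σ : V → ℤˣ, w σ * f₄ σ) * (∑ σ : V → ℤˣ, w σ * g₄ σ) := by
  rw [← dsum_factor w f₁ g₁, ← dsum_factor w f₂ g₂, ← dsum_factor w f₃ g₃,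
    ← dsum_factor w f₄ g₄, ← Finset.sum_add_distrib, ← Finset.sum_sub_distrib,
    ← Finset.sum_sub_distrib]
  refine Finset.sum_congr rfl fun σ _ => ?_
  rw [← Finset.sum_add_distrib, ← Finset.sum_sub_distrib, ← Finset.sum_sub_distrib]
  exact Finset.sum_congr rfl fun σ' _ => by ring

variable {w}

/-- **Spin-flip symmetrisation of the second replica.** For an even weight,
`2 ∑_{σ,σ'} w w' P(σ,σ') = ∑_{σ,σ'} w w' (P(σ,σ') + P(σ,-σ'))`. -/
theorem dsum_symm (hw : ∀ σ, w (-σ) = w σ) (P : (V → ℤˣ) → (V → ℤˣ) → ℝ) :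
    2 * ∑ σ : V → ℤˣ, ∑ σ' : V → ℤˣ, w σ * w σ' * P σ σ' =
      ∑ σ : V → ℤˣ, ∑ σ' : V → ℤˣ, w σ * w σ' * (P σ σ' + P σ (-σ')) := by
  have h : ∀ σ : V → ℤˣ, ∑ σ' : V → ℤˣ, w σ * w σ' * P σ σ' =
      ∑ σ' : V → ℤˣ, w σ * w σ' * P σ (-σ') := fun σ =>
    Fintype.sum_equiv (Equiv.neg _) _ _ fun σ' => by simp [hw]
  rw [two_mul, ← Finset.sum_add_distrib]
  refine Finset.sum_congr rfl fun σ _ => ?_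
  conv_lhs => arg 2; rw [h σ]
  rw [← Finset.sum_add_distrib]
  exact Finset.sum_congr rfl fun σ' _ => by ring

/-- **Evaluation of a double replica sum by symmetrisation**: if `c (P + P(σ,-σ'))` is pointwise
the swap-symmetrisation `F(σ,σ') + F(σ',σ)` of some `F`, then `c ∑∑ w w' P = ∑∑ w w' F`. -/
theorem dsum_eq_of_symm (hw : ∀ σ, w (-σ) = w σ) (P F : (V → ℤˣ) → (V → ℤˣ) → ℝ) (c : ℝ)
    (h : ∀ σ σ', c * (P σ σ' + P σ (-σ')) = F σ σ' + F σ' σ) :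
    c * ∑ σ : V → ℤˣ, ∑ σ' : V → ℤˣ, w σ * w σ' * P σ σ' =
      ∑ σ : V → ℤˣ, ∑ σ' : V → ℤˣ, w σ * w σ' * F σ σ' := by
  have h1 := dsum_symm hw P
  have h2 : ∑ σ : V → ℤˣ, ∑ σ' : V → ℤˣ, w σ * w σ' * F σ' σ =
      ∑ σ : V → ℤˣ, ∑ σ' : V → ℤˣ, w σ * w σ' * F σ σ' := by
    rw [Finset.sum_comm]
    exact Finset.sum_congr rfl fun σ _ => Finset.sum_congr rfl fun σ' _ => by ring
  have h3 : c * ∑ σ : V → ℤˣ, ∑ σ' : V → ℤˣ, w σ * w σ' * (P σ σ' + P σ (-σ')) =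
      ∑ σ : V → ℤˣ, ∑ σ' : V → ℤˣ, w σ * w σ' * F σ σ' +
        ∑ σ : V → ℤˣ, ∑ σ' : V → ℤˣ, w σ * w σ' * F σ' σ := by
    rw [Finset.mul_sum, ← Finset.sum_add_distrib]
    refine Finset.sum_congr rfl fun σ _ => ?_
    rw [Finset.mul_sum, ← Finset.sum_add_distrib]
    refine Finset.sum_congr rfl fun σ' _ => ?_
    linear_combination (w σ * w σ') * h σ σ'
  linear_combination (c / 2) * h1 + (1 / 2 : ℝ) * h3 + (1 / 2 : ℝ) * h2

/-- Blue pair: `∑∑ w w' (σ_x+σ'_x)/2 (σ_y+σ'_y)/2 = Z · M_{xy} / 2`. -/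
theorem dsum_pair_plus (hw : ∀ σ, w (-σ) = w σ) (x y : V) :
    ∑ σ : V → ℤˣ, ∑ σ' : V → ℤˣ, w σ * w σ' *
        ((spinAt x σ + spinAt x σ') / 2 * ((spinAt y σ + spinAt y σ') / 2)) =
      (∑ σ : V → ℤˣ, w σ) * (∑ σ : V → ℤˣ, w σ * (spinAt x σ * spinAt y σ)) / 2 := by
  have key := dsum_eq_of_symm hw
    (fun σ σ' => (spinAt x σ + spinAt x σ') / 2 * ((spinAt y σ + spinAt y σ') / 2))
    (fun σ σ' => (1 : ℝ) * (spinAt x σ' * spinAt y σ')) 2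
    (fun σ σ' => by simp only [spinAt_neg]; ring)
  rw [dsum_factor] at key
  simp only [mul_one] at key
  linear_combination (1 / 2 : ℝ) * key

/-- Red pair: `∑∑ w w' (σ_x-σ'_x)/2 (σ_y-σ'_y)/2 = Z · M_{xy} / 2`. -/
theorem dsum_pair_minus (hw : ∀ σ, w (-σ) = w σ) (x y : V) :
    ∑ σ : V → ℤˣ, ∑ σ' : V → ℤˣ, w σ * w σ' *
        ((spinAt x σ - spinAt x σ') / 2 * ((spinAt y σ - spinAt y σ') / 2)) =
      (∑ σ : V → ℤˣ, w σ) * (∑ σ : V → ℤˣ, w σ * (spinAt x σ * spinAt y σ)) / 2 := by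
  have key := dsum_eq_of_symm hw
    (fun σ σ' => (spinAt x σ - spinAt x σ') / 2 * ((spinAt y σ - spinAt y σ') / 2))
    (fun σ σ' => (1 : ℝ) * (spinAt x σ' * spinAt y σ')) 2
    (fun σ σ' => by simp only [spinAt_neg]; ring)
  rw [dsum_factor] at key
  simp only [mul_one] at key
  linear_combination (1 / 2 : ℝ) * key

/-- Blue pair times red pair: `8 ∑∑ w w' ∏ (σ ± σ')/2 = Z M₀₁₂₃ + M₀₁M₂₃ − M₀₂M₁₃ − M₀₃M₁₂`. -/
theorem dsum_four (hw : ∀ σ, w (-σ) = w σ) (x₀ x₁ x₂ x₃ : V) :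
    8 * ∑ σ : V → ℤˣ, ∑ σ' : V → ℤˣ, w σ * w σ' *
        ((spinAt x₀ σ + spinAt x₀ σ') / 2 * ((spinAt x₁ σ + spinAt x₁ σ') / 2) *
          ((spinAt x₂ σ - spinAt x₂ σ') / 2 * ((spinAt x₃ σ - spinAt x₃ σ') / 2))) =
      (∑ σ : V → ℤˣ, w σ) *
          (∑ σ : V → ℤˣ, w σ * (spinAt x₀ σ * spinAt x₁ σ * spinAt x₂ σ * spinAt x₃ σ)) +
        (∑ σ : V → ℤˣ, w σ * (spinAt x₀ σ * spinAt x₁ σ)) *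
          (∑ σ : V → ℤˣ, w σ * (spinAt x₂ σ * spinAt x₃ σ)) -
        (∑ σ : V → ℤˣ, w σ * (spinAt x₀ σ * spinAt x₂ σ)) *
          (∑ σ : V → ℤˣ, w σ * (spinAt x₁ σ * spinAt x₃ σ)) -
        (∑ σ : V → ℤˣ, w σ * (spinAt x₀ σ * spinAt x₃ σ)) *
          (∑ σ : V → ℤˣ, w σ * (spinAt x₁ σ * spinAt x₂ σ)) := by
  have key := dsum_eq_of_symm hw
    (fun σ σ' => (spinAt x₀ σ + spinAt x₀ σ') / 2 * ((spinAt x₁ σ + spinAt x₁ σ') / 2) *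
      ((spinAt x₂ σ - spinAt x₂ σ') / 2 * ((spinAt x₃ σ - spinAt x₃ σ') / 2)))
    (fun σ σ' => (1 : ℝ) * (spinAt x₀ σ' * spinAt x₁ σ' * spinAt x₂ σ' * spinAt x₃ σ') +
      spinAt x₀ σ * spinAt x₁ σ * (spinAt x₂ σ' * spinAt x₃ σ') -
      spinAt x₀ σ * spinAt x₂ σ * (spinAt x₁ σ' * spinAt x₃ σ') -
      spinAt x₀ σ * spinAt x₃ σ * (spinAt x₁ σ' * spinAt x₂ σ')) 8
    (fun σ σ' => by simp only [spinAt_neg]; ring)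
  rw [key, dsum_combo]
  simp only [mul_one]

end Algebra

/-! ## The sponge sums of the statement -/

section Sponge

variable (G : SimpleGraph V) [DecidableRel G.Adj]

omit [Fintype V] [DecidableEq V] in
/-- `σ_e(-σ) = σ_e(σ)`. -/
theorem bondSpin_neg (σ : V → ℤˣ) (e : Sym2 V) : bondSpin (-σ) e = bondSpin σ e := by
  induction e using Sym2.ind with
  | _ x y => simp [spinAt_neg]

/-- The free zero-field weight of a full configuration is even. -/
theorem exp_energy_neg (β : ℝ) (Λ : Finset V) (σ : V → ℤˣ) :
    Real.exp (β * ∑ e ∈ edgesIn G Λ, bondSpin (-σ) e) =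
      Real.exp (β * ∑ e ∈ edgesIn G Λ, bondSpin σ e) := by
  simp_rw [bondSpin_neg]

/-- The Boltzmann numerator of the empty spin product is the partition function. -/
theorem sum_isingWeight_mul_spinProduct_empty (Λ : Finset V) (β h : ℝ)
    (bc : BoundaryCondition V) :
    ∑ τ : Λ → ℤˣ, isingWeight G Λ β h bc τ * spinProduct ∅ (glue Λ τ bc) =
      isingPartitionFunction G Λ β h bc := by
  simp [spinProduct, isingPartitionFunction]

/-- **Sponge normalisation**: `∑_A Z^free_{A;2β} Z^free_{Aᶜ;2β} = (Z^free_{G;β})²`. -/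
theorem sponge_norm (β : ℝ) :
    ∑ A : Finset V, isingPartitionFunction G A (2 * β) 0 .free *
        isingPartitionFunction G Aᶜ (2 * β) 0 .free =
      (∑ σ : V → ℤˣ, Real.exp (β * ∑ e ∈ edgesIn G univ, bondSpin σ e)) *
        ∑ σ : V → ℤˣ, Real.exp (β * ∑ e ∈ edgesIn G univ, bondSpin σ e) := by
  have h := sponge_sum_eq G β ∅ ∅
  simp only [Finset.prod_empty, mul_one] at h
  rw [← Finset.sum_mul_sum] at h
  rw [h]
  refine Finset.sum_congr rfl fun A _ => ?_
  rw [if_pos ⟨Finset.empty_subset _, Finset.empty_subset _⟩,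
    sum_isingWeight_mul_spinProduct_empty, sum_isingWeight_mul_spinProduct_empty]

/-- **Blue is half the pair correlation** (numerator form):
`∑_A Zs(A) X_{xy}(A) = Z · M_{xy} / 2` for `x ≠ y`. -/
theorem sponge_pair_in (β : ℝ) {x y : V} (hxy : x ≠ y) :
    ∑ A : Finset V, isingPartitionFunction G A (2 * β) 0 .free *
        isingPartitionFunction G Aᶜ (2 * β) 0 .free *
        (if x ∈ A ∧ y ∈ A then isingCorr G A (2 * β) 0 .free {x, y} else 0) =
      (∑ σ : V → ℤˣ, Real.exp (β * ∑ e ∈ edgesIn G univ, bondSpin σ e)) *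
        (∑ σ : V → ℤˣ, Real.exp (β * ∑ e ∈ edgesIn G univ, bondSpin σ e) *
          (spinAt x σ * spinAt y σ)) / 2 := by
  have h := sponge_sum_eq G β {x, y} ∅
  simp only [Finset.prod_pair hxy, Finset.prod_empty, mul_one] at h
  rw [dsum_pair_plus (exp_energy_neg G β univ) x y] at h
  rw [h]
  refine Finset.sum_congr rfl fun A _ => ?_
  by_cases hA : x ∈ A ∧ y ∈ A
  · have hsub : {x, y} ⊆ A := by simp [Finset.insert_subset_iff, hA.1, hA.2]
    rw [if_pos hA, if_pos ⟨hsub, Finset.empty_subset _⟩,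
      sum_isingWeight_mul_spinProduct_empty, ← isingCorr_mul_partitionFunction]
    ring
  · have hsub : ¬ ({x, y} ⊆ A) := fun h' => hA ⟨h' (by simp), h' (by simp)⟩
    rw [if_neg hA, if_neg fun h' => hsub h'.1, mul_zero]

/-- **Red is half the pair correlation** (numerator form):
`∑_A Zs(A) Y_{xy}(A) = Z · M_{xy} / 2` for `x ≠ y`. -/
theorem sponge_pair_out (β : ℝ) {x y : V} (hxy : x ≠ y) :
    ∑ A : Finset V, isingPartitionFunction G A (2 * β) 0 .free *
        isingPartitionFunction G Aᶜ (2 * β) 0 .free *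
        (if x ∉ A ∧ y ∉ A then isingCorr G Aᶜ (2 * β) 0 .free {x, y} else 0) =
      (∑ σ : V → ℤˣ, Real.exp (β * ∑ e ∈ edgesIn G univ, bondSpin σ e)) *
        (∑ σ : V → ℤˣ, Real.exp (β * ∑ e ∈ edgesIn G univ, bondSpin σ e) *
          (spinAt x σ * spinAt y σ)) / 2 := by
  have h := sponge_sum_eq G β ∅ {x, y}
  simp only [Finset.prod_pair hxy, Finset.prod_empty, one_mul] at h
  rw [dsum_pair_minus (exp_energy_neg G β univ) x y] at h
  rw [h]
  refine Finset.sum_congr rfl fun A _ => ?_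
  by_cases hA : x ∉ A ∧ y ∉ A
  · have hsub : {x, y} ⊆ Aᶜ := by
      simp [Finset.insert_subset_iff, Finset.mem_compl, hA.1, hA.2]
    rw [if_pos hA, if_pos ⟨Finset.empty_subset _, hsub⟩,
      sum_isingWeight_mul_spinProduct_empty, ← isingCorr_mul_partitionFunction]
    ring
  · have hsub : ¬ ({x, y} ⊆ Aᶜ) := fun h' =>
      hA ⟨Finset.mem_compl.1 (h' (by simp)), Finset.mem_compl.1 (h' (by simp))⟩
    rw [if_neg hA, if_neg fun h' => hsub h'.2, mul_zero]

/-- **The blue–red sponge product** (numerator form): for `x₀ ≠ x₁`, `x₂ ≠ x₃`,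
`8 ∑_A Zs(A) X_{x₀x₁}(A) Y_{x₂x₃}(A) = Z M_{0123} + M₀₁M₂₃ − M₀₂M₁₃ − M₀₃M₁₂`. -/
theorem sponge_four (β : ℝ) {x₀ x₁ x₂ x₃ : V} (h01 : x₀ ≠ x₁) (h23 : x₂ ≠ x₃) :
    8 * ∑ A : Finset V, isingPartitionFunction G A (2 * β) 0 .free *
        isingPartitionFunction G Aᶜ (2 * β) 0 .free *
        ((if x₀ ∈ A ∧ x₁ ∈ A then isingCorr G A (2 * β) 0 .free {x₀, x₁} else 0) *
          (if x₂ ∉ A ∧ x₃ ∉ A then isingCorr G Aᶜ (2 * β) 0 .free {x₂, x₃} else 0)) =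
      (∑ σ : V → ℤˣ, Real.exp (β * ∑ e ∈ edgesIn G univ, bondSpin σ e)) *
          (∑ σ : V → ℤˣ, Real.exp (β * ∑ e ∈ edgesIn G univ, bondSpin σ e) *
            (spinAt x₀ σ * spinAt x₁ σ * spinAt x₂ σ * spinAt x₃ σ)) +
        (∑ σ : V → ℤˣ, Real.exp (β * ∑ e ∈ edgesIn G univ, bondSpin σ e) *
            (spinAt x₀ σ * spinAt x₁ σ)) *
          (∑ σ : V → ℤˣ, Real.exp (β * ∑ e ∈ edgesIn G univ, bondSpin σ e) *
            (spinAt x₂ σ * spinAt x₃ σ)) -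
        (∑ σ : V → ℤˣ, Real.exp (β * ∑ e ∈ edgesIn G univ, bondSpin σ e) *
            (spinAt x₀ σ * spinAt x₂ σ)) *
          (∑ σ : V → ℤˣ, Real.exp (β * ∑ e ∈ edgesIn G univ, bondSpin σ e) *
            (spinAt x₁ σ * spinAt x₃ σ)) -
        (∑ σ : V → ℤˣ, Real.exp (β * ∑ e ∈ edgesIn G univ, bondSpin σ e) *
            (spinAt x₀ σ * spinAt x₃ σ)) *
          (∑ σ : V → ℤˣ, Real.exp (β * ∑ e ∈ edgesIn G univ, bondSpin σ e) *
            (spinAt x₁ σ * spinAt x₂ σ)) := by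
  have h := sponge_sum_eq G β {x₀, x₁} {x₂, x₃}
  simp only [Finset.prod_pair h01, Finset.prod_pair h23] at h
  rw [← dsum_four (exp_energy_neg G β univ) x₀ x₁ x₂ x₃, h]
  congr 1
  refine Finset.sum_congr rfl fun A _ => ?_
  by_cases hA : x₀ ∈ A ∧ x₁ ∈ A
  · by_cases hA' : x₂ ∉ A ∧ x₃ ∉ A
    · have hsub : {x₀, x₁} ⊆ A := by simp [Finset.insert_subset_iff, hA.1, hA.2]
      have hsub' : {x₂, x₃} ⊆ Aᶜ := by
        simp [Finset.insert_subset_iff, Finset.mem_compl, hA'.1, hA'.2]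
      rw [if_pos hA, if_pos hA', if_pos ⟨hsub, hsub'⟩, ← isingCorr_mul_partitionFunction,
        ← isingCorr_mul_partitionFunction]
      ring
    · have hsub' : ¬ ({x₀, x₁} ⊆ A ∧ {x₂, x₃} ⊆ Aᶜ) := fun h' =>
        hA' ⟨Finset.mem_compl.1 (h'.2 (by simp)), Finset.mem_compl.1 (h'.2 (by simp))⟩
      rw [if_neg hA', if_neg hsub', mul_zero, mul_zero]
  · have hsub : ¬ ({x₀, x₁} ⊆ A ∧ {x₂, x₃} ⊆ Aᶜ) := fun h' => hA ⟨h'.1 (by simp), h'.1 (by simp)⟩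
    rw [if_neg hA, if_neg hsub, zero_mul, mul_zero]

end Sponge

/-! ## The stub -/

/-- **stub_replicaIdentities** (line `Sketch` of crux `StrandShadow`): the two-replica
(agreement sponge) identities on a finite graph — with sponge weights `Z^free_A(2β)·Z^free_{Aᶜ}(2β)`,
blue `X(A) = 1[a₀,a₁ ∈ A]⟨σ₀σ₁⟩^free_{A,2β}` and red `Y(A) = 1[a₂,a₃ ∉ A]⟨σ₂σ₃⟩^free_{Aᶜ,2β}`:
`U₄(a) = 8(E[XY] − E[X]E[Y])`, `G₀₁ = 2E[X]`, `G₂₃ = 2E[Y]` (zero field, free b.c., `a`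
injective, any real `β`; Lebowitz 1974 duplicated variables, Aizenman 1982 §5). -/
theorem stub_replicaIdentities :
    ∀ (V : Type) [Fintype V] [DecidableEq V] (G : SimpleGraph V) [DecidableRel G.Adj] (β : ℝ)
      (a : Fin 4 → V), Function.Injective a →
      (let Zs : Finset V → ℝ := fun A =>
         isingPartitionFunction G A (2 * β) 0 .free * isingPartitionFunction G Aᶜ (2 * β) 0 .free
       let X : Finset V → ℝ := fun A =>
         if a 0 ∈ A ∧ a 1 ∈ A then isingCorr G A (2 * β) 0 .free {a 0, a 1} else 0
       let Y : Finset V → ℝ := fun A =>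
         if a 2 ∉ A ∧ a 3 ∉ A then isingCorr G Aᶜ (2 * β) 0 .free {a 2, a 3} else 0
       let E : (Finset V → ℝ) → ℝ := fun f => (∑ A : Finset V, Zs A * f A) / ∑ A : Finset V, Zs A
       let Gc : Fin 4 → Fin 4 → ℝ := fun i j => isingCorr G Finset.univ β 0 .free {a i, a j}
       isingCorr G Finset.univ β 0 .free (Finset.univ.image a)
           - (Gc 0 1 * Gc 2 3 + Gc 0 2 * Gc 1 3 + Gc 0 3 * Gc 1 2)
         = 8 * (E (fun A => X A * Y A) - E X * E Y) ∧
       Gc 0 1 = 2 * E X ∧ Gc 2 3 = 2 * E Y) := by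
  intro V _ _ G _ β a ha
  dsimp only
  have h01 : a 0 ≠ a 1 := ha.ne (by decide)
  have h23 : a 2 ≠ a 3 := ha.ne (by decide)
  have h02 : a 0 ≠ a 2 := ha.ne (by decide)
  have h13 : a 1 ≠ a 3 := ha.ne (by decide)
  have h03 : a 0 ≠ a 3 := ha.ne (by decide)
  have h12 : a 1 ≠ a 2 := ha.ne (by decide)
  have hSXY := sponge_four G β h01 h23
  rw [sponge_pair_in G β h01, sponge_pair_out G β h23, sponge_norm G β]
  simp only [isingCorr_univ_eq G β, spinProduct, Finset.prod_pair h01, Finset.prod_pair h23,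
    Finset.prod_pair h02, Finset.prod_pair h13, Finset.prod_pair h03, Finset.prod_pair h12,
    Finset.prod_image fun i _ j _ h => ha h, Fin.prod_univ_four]
  have hZ : (0 : ℝ) < ∑ σ : V → ℤˣ, Real.exp (β * ∑ e ∈ edgesIn G univ, bondSpin σ e) :=
    Finset.sum_pos (fun σ _ => Real.exp_pos _) Finset.univ_nonempty
  set Z := ∑ σ : V → ℤˣ, Real.exp (β * ∑ e ∈ edgesIn G univ, bondSpin σ e) with hZdef
  set SXY := ∑ A : Finset V, isingPartitionFunction G A (2 * β) 0 .free *
        isingPartitionFunction G Aᶜ (2 * β) 0 .free *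
        ((if a 0 ∈ A ∧ a 1 ∈ A then isingCorr G A (2 * β) 0 .free {a 0, a 1} else 0) *
          (if a 2 ∉ A ∧ a 3 ∉ A then isingCorr G Aᶜ (2 * β) 0 .free {a 2, a 3} else 0))
    with hSXYdef
  have hZ' : Z ≠ 0 := hZ.ne'
  have hSXY' := (eq_div_iff (by norm_num : (8 : ℝ) ≠ 0)).2 ((mul_comm _ _).trans hSXY)
  rw [hSXY']
  refine ⟨?_, ?_, ?_⟩
  · field_simp
    ring
  · field_simp
  · field_simp

end Summit.CriticalPhenomena.Ising3DConformalLimit.Theorems.StrandShadowSketch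

end
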